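import Summits.BirchSwinnertonDyer.BirchSwinnertonDyer.Theorems.GoldfeldAllTwistsTwoConverseAtTwoGlue
import HarnessLib

/-! # Candidate skeleton «cells-v2» — crux K12₂′ `RankOneTwoConverseCMSevenAtAnyTwo` of route `GoldfeldAllTwistsTwoConverse`
(item stmt-BirchSwinnertonDyer-19349; leafhand `leafhand-bsd-goldfeldalltwistst-1` g0, 2026-08-30; NOT registered by this seat —
offered to the route owner / ladder director as the replacement of the birth skeleton `Lines/birth.lean` sha16 9e7b3962da790c1f)

WHY: of the three birth stubs, `stub_modelReduction` is a tree theorem (closed BY NAME by this seat,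
`Theorems/GoldfeldAllTwistsTwoConverseRankOneTwoConverseCMSevenAtAnyTwoStubModelReduction.lean`), `stub_twoConverse_good` is
the `p = 2` slice of Burungale–Castella–Skinner–Tian 2022 Thm. A restricted to `j = −3375` (a PRINT, never closable by name as
registered: no `_holds` of `BurungaleCastellaSkinnerTian2022.ThmA_at_two` in the tree), and `stub_twoConverse_additive` is
VERBATIM the child crux K12₂″ (item 20044). The item is already SPLIT on the ledger (gen 1: 20044 + 20045 + glue 20046, glue
PROVED). This skeleton states the same split with TWO stubs that are declarations of the tree BY NAME — one named print, one
child crux — and the composition is the landed glue at `2`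
(`GoldfeldGoodTwists.rankOneTwoConverseCMSevenAtAnyTwo_of_cells_at_two`, file `…AtTwoGlue`, binder-free exactness
`rankOneTwoConverseCMSevenAtAnyTwo_iff_additiveCell_and_thmA_at_two : K12₂′ ↔ K12₂″ ∧ ThmA_at_two`). Sorries ONLY in `stub_*`.
HONEST FRAMING: bookkeeping; nothing here proves K12₂′, K12₂″, Theorem A or BSD. -/

set_option linter.dupNamespace false
set_option autoImplicit false

namespace Summit.BirchSwinnertonDyer.BirchSwinnertonDyer.Cruxes.RankOneTwoConverseCMSevenAtAnyTwo.CellsV2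

open Summit.BirchSwinnertonDyer.BirchSwinnertonDyer.Theses.GoldfeldAllTwistsTwoConverse
open Literature.NumberTheory.EllipticCurves.BurungaleCastellaSkinnerTian2022

/-- STUB (PRINT, by name): the `p = 2` slice of Burungale–Castella–Skinner–Tian 2022 Thm. A — the Literature fact
`BurungaleCastellaSkinnerTian2022.ThmA_at_two` (refereed statement; literature-formalisation debt; equivalent on this crux to
the route's support item 20045 `BCSTThmARankOneConverse` restricted to `p = 2`, projection `thmA_at_two_of_thmA`). -/
theorem stub_thmA_at_two : ThmA_at_two := by
  sorry

/-- STUB (CHILD CRUX, by name): the additive cell K12₂″ = route decl `RankOneTwoConverseCMSevenAdditiveTwo` (item 20044,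
registered skeleton v7.4 «sevens-halves»). -/
theorem stub_additiveCell : RankOneTwoConverseCMSevenAdditiveTwo := by
  sorry

/-- Composition (PROVED, no sorry of its own): the crux BY NAME from the two stubs, via the landed glue at `2`. -/
theorem RankOneTwoConverseCMSevenAtAnyTwo_of : RankOneTwoConverseCMSevenAtAnyTwo :=
  Summit.BirchSwinnertonDyer.BirchSwinnertonDyer.Theorems.GoldfeldGoodTwists.rankOneTwoConverseCMSevenAtAnyTwo_of_cells_at_two
    stub_thmA_at_two stub_additiveCell

end Summit.BirchSwinnertonDyer.BirchSwinnertonDyer.Cruxes.RankOneTwoConverseCMSevenAtAnyTwo.CellsV2
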